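import Summits.Ventures.PercRepro.Night2T3RankFiveCoreFree
import Summits.Ventures.PercRepro.GenQSevenFiveTypeTwo
import Summits.Ventures.PercRepro.Night2CoreFlatFive

/-!
# PercRepro — the `(7, 5)` low layers on the core: the type-`3` clause closes with `f(5) ≤ 21` (night-2, gen 4)

RULING (sk): the reduction of record for `(7, 5)` on the core is the type-`3` clause
`SevenFiveTypeThreeCoreFree` (night-4, `GenQSevenFiveTypeTwo`: `∀ M, Core M 7 → ∀ G ∈ flatsQ M 5, mTr M G = 0 →
0 ≤ Jq M G 5 3`), the type-`2` clause being night-4's `jq_two_nonneg_of_core_five`.  THEOREM R5″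
(`Night2T3RankFiveCoreFree`: `Jq_three_nonneg_q5_of_card_le_twentyone_free`, the coloop-free cut of R5′) gives the
type-`3` balance on every coloop-free rank-`5` set with `≤ 21` points of a simple matroid, so the clause needs only a
size bound on the rank-`5` flats of the core:

* `card_le_twentyone_of_core_of_ten` (`Night2CoreFlatFive`): `f(5) ≤ 2·f(4) + 1` — once every rank-`4` flat of the
  core has `≤ 10` points (mine-4's `f(4) ≤ 10`, typed by p2 as `card_le_ten_of_core`), every rank-`5` flat has `≤ 21`;
* `Jq_three_nonneg_five_of_core_of_ten`: the type-`3` balance on every coloop-free rank-`5` flat of a Core matroid,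
  under the rank-`4` bound (R5″ at `≤ 21` points);
* **`sevenFiveTypeThreeCoreFree_of_ten`**: the rank-`4` bound (on every Core matroid) gives
  `SevenFiveTypeThreeCoreFree`, hence `sevenFiveLowLayersCoreFree_of_ten` and **`rls_seven_five_of_ten`**: with
  night-4's trace sums and corners (ii), (iii) on the core, `RLS M 7 5` on every finite matroid.

The rank-`4` bound is a hypothesis here (p2's module is not yet landed); instantiating it is a two-line file.
Imports `Night2T3RankFiveCoreFree`, `GenQSevenFiveTypeTwo` and `Night2CoreFlatFive`.
-/
namespace PercRepro.Star

open Finset ThmH SixFour GenQ PerFlat ThmN NightThree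

variable {α : Type*} [DecidableEq α] {M : Matroid α} [M.Finite]

/-- **The type-`3` balance on the coloop-free rank-`5` flats of a Core matroid**, under the rank-`4` bound:
THEOREM R5″ at `|G| ≤ 21`. -/
theorem Jq_three_nonneg_five_of_core_of_ten {γ : Type} [DecidableEq γ] {M : Matroid γ} [M.Finite] {p : ℕ}
    (hc : Core M p) (h10 : ∀ F ∈ flatsQ M 4, F.card ≤ 10) {G : Finset γ} (hG : G ∈ flatsQ M 5)
    (hm : mTr M G = 0) : 0 ≤ Jq M G 5 3 := by
  have hG' := mem_flatsQ.1 hG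
  have hs : Simple M := simple_of_core hc
  have h21 : G.card ≤ 21 := card_le_twentyone_of_core_of_ten hc h10 hG
  exact Jq_three_nonneg_q5_of_card_le_twentyone_free hs hG'.1 hG'.2.2 h21 hm

/-- **`SevenFiveTypeThreeCoreFree` from the rank-`4` flat bound**: R5′ with `f(5) ≤ 21`. -/
theorem sevenFiveTypeThreeCoreFree_of_ten
    (h10 : ∀ {β : Type} [DecidableEq β] (M : Matroid β) [M.Finite] {p : ℕ}, Core M p →
      ∀ F ∈ flatsQ M 4, F.card ≤ 10) : SevenFiveTypeThreeCoreFree := by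
  intro β _ M _ G hc hG hm
  exact Jq_three_nonneg_five_of_core_of_ten hc (h10 M hc) hG hm

/-- **`SevenFiveLowLayersCoreFree` from the rank-`4` flat bound**: night-4's type-`2` clause and the type-`3`
clause above. -/
theorem sevenFiveLowLayersCoreFree_of_ten
    (h10 : ∀ {β : Type} [DecidableEq β] (M : Matroid β) [M.Finite] {p : ℕ}, Core M p →
      ∀ F ∈ flatsQ M 4, F.card ≤ 10) : SevenFiveLowLayersCoreFree :=
  sevenFiveLowLayersCoreFree_of_typeThree (sevenFiveTypeThreeCoreFree_of_ten h10)

/-- **C-025 at `(7, 5)` on every finite matroid** from the rank-`4` flat bound on the core, night-4's trace sums and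
its corners (ii), (iii) on the core. -/
theorem rls_seven_five_of_ten {γ : Type} [DecidableEq γ]
    (h10 : ∀ {β : Type} [DecidableEq β] (M : Matroid β) [M.Finite] {p : ℕ}, Core M p →
      ∀ F ∈ flatsQ M 4, F.card ≤ 10)
    (htr : SevenFiveTraceSumsCore) (h2 : SevenFiveCornerTwoCore) (h3 : SevenFiveCornerThreeCore)
    (M : Matroid γ) [M.Finite] : RLS M 7 5 :=
  rls_seven_five_of_cornersFree' htr h2 h3 (sevenFiveTypeThreeCoreFree_of_ten h10) M

end PercRepro.Star
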